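import Summits.KontsevichZagierPeriods.KontsevichZagierPeriods.Theorems.StuffleInKZ.Negative.AdditivityOnly
import Summits.KontsevichZagierPeriods.KontsevichZagierPeriods.Theorems.StuffleInKZ.Negative.AlgebraicShadow
import Summits.KontsevichZagierPeriods.KontsevichZagierPeriods.Theorems.StuffleInKZ.Negative.MarginalSeries

/-!
# `StuffleInKZ` (stmt-3931), negative side, cycle 3 Part II — the first-axis marginals of
# `Δ₄`, `Δ_{2,2}`, `Δ₂ × Δ₂`, and of the first genuine stuffle defect

For `x ∈ (0,1)` (the first = largest simplex coordinate):

* `sliceValue [Δ₄, ω₀ω₀ω₀ω₁] x      = Li₃(x)/x`      (`sliceValue_m4`);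
* `sliceValue [Δ_{2,2}, ω₀ω₁ω₀ω₁] x = Li_{1,2}(x)/x` (`sliceValue_m22`);
* `sliceValue [Δ₂ × Δ₂, ω⊗ω] x     = ζ₂ ℓ(x)/x`, `ℓ(x) = −log(1−x)`, `ζ₂ = value [Δ₂, ω₀ω₁]`
  (`sliceValue_p22`);

hence the marginal of the defect `D = [Δ₂]² − 2[Δ_{2,2}] − [Δ₄]` (`defect Zcan [2] [2]`) is
`sliceEval D x = (ζ₂ ℓ(x) − 2 Li_{1,2}(x) − Li₃(x))/x` on `(0,1)` (`sliceEval_defect_two_two`).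
Slicing by the tree's `KZ.MZVSimplex.cons_mem_simplexLT`; the product slice by Fubini over
`ℝ × ℝ²` (`KZ.measurePreserving_vecCons`, `integral_prod_mul`). [folklore]
-/

noncomputable section

namespace Summit.KontsevichZagierPeriods.Theorems.StuffleInKZ.Negative

namespace Slices

open MeasureTheory Set Filter ENNReal
open Literature.NumberTheory.Transcendental
open Literature.NumberTheory.Transcendental.KZ
open Literature.NumberTheory.Transcendental.KZ.MZVSimplex
open Literature.NumberTheory.Transcendental.MZV (IsAdmissible)
open Series

/-! ### The representations -/

/-- `[Δ₄, ω₀ω₀ω₀ω₁]` (`ζ(4)`). -/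
abbrev m4 : IntegralRep 4 :=
  mzvRep [4] (by decide) (mzvIntegrand_isSemialgebraicFunOn_holds [4])
    (mzvIntegrand_integrableOn_holds [4] (by decide))

/-- `[Δ_{2,2}, ω₀ω₁ω₀ω₁]` (`ζ(2,2)`). -/
abbrev m22 : IntegralRep 4 :=
  mzvRep [2, 2] (by decide) (mzvIntegrand_isSemialgebraicFunOn_holds [2, 2])
    (mzvIntegrand_integrableOn_holds [2, 2] (by decide))

/-- `[Δ₂, ω₀ω₁]` (`ζ(2)`). -/
abbrev m2 : IntegralRep 2 :=
  mzvRep [2] (by decide) (mzvIntegrand_isSemialgebraicFunOn_holds [2])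
    (mzvIntegrand_integrableOn_holds [2] (by decide))

/-- `[Δ₂ × Δ₂, ω⊗ω]` (`ζ(2)²`). -/
abbrev p22 : IntegralRep 4 := prodRep [2] [2] (by decide) (by decide)

/-- `ζ₂ := value [Δ₂, ω₀ω₁]` (a positive real; `= ζ(2)` by Kontsevich's formula, not needed). -/
def ζ₂ : ℝ := m2.value

/-- The real three-variable word integrand `∏_{i<3} ω_{εᵢ}(tᵢ)`. -/
abbrev W3 (ε : List Bool) (t : Fin 3 → ℝ) : ℝ := ∏ i : Fin 3, mzvForm (ε.getD i false) (t i)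

/-- The simplex below `x` in `ℝ³`. -/
abbrev S3 (x : ℝ) : Set (Fin 3 → ℝ) := {t | (∀ i, 0 < t i) ∧ (∀ i, t i < x) ∧ StrictAnti t}

/-! ### Real word integrals over `S3 x` are `toReal` of the `ℝ≥0∞` ones -/

/-- The forms `ω₀`, `ω₁` are nonnegative on `(0,1)`. [folklore] -/
theorem mzvForm_nonneg (b : Bool) {y : ℝ} (h0 : 0 < y) (h1 : y < 1) : 0 ≤ mzvForm b y :=
  (mzvForm_pos b h0 h1).le

/-- On `S3 x` (`x ≤ 1`) the word integrand is nonnegative. [folklore] -/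
theorem W3_nonneg (ε : List Bool) {x : ℝ} (hx1 : x ≤ 1) {t : Fin 3 → ℝ} (ht : t ∈ S3 x) :
    0 ≤ W3 ε t :=
  Finset.prod_nonneg fun i _ => mzvForm_nonneg _ (ht.1 i) ((ht.2.1 i).trans_le hx1)

/-- `W3 ε` is measurable. [folklore] -/
theorem measurable_W3 (ε : List Bool) : Measurable (W3 ε) := by
  refine Finset.measurable_prod _ fun i _ => ?_
  exact (measurable_mzvForm _).comp (measurable_pi_apply i)

/-- `∫_{S3 x} W3 ε = (Λ_ε^3(x)).toReal` for `x ≤ 1`. [folklore] -/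
theorem setIntegral_W3 (ε : List Bool) {x : ℝ} (hx1 : x ≤ 1) :
    ∫ t in S3 x, W3 ε t = (wordLI ε 3 x).toReal := by
  have hS : MeasurableSet (S3 x) := measurableSet_simplexLT 3 x
  have hae : 0 ≤ᵐ[volume.restrict (S3 x)] W3 ε :=
    (ae_restrict_iff' hS).2 (ae_of_all _ fun t ht => W3_nonneg ε hx1 ht)
  rw [integral_eq_lintegral_of_nonneg_ae hae (measurable_W3 ε).aestronglyMeasurable]
  congr 1
  exact setLIntegral_congr_fun hS fun t ht =>
    ENNReal.ofReal_prod_of_nonneg fun i _ => mzvForm_nonneg _ (ht.1 i) ((ht.2.1 i).trans_le hx1)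

/-! ### Slices of the two simplex representations -/

/-- The slice of `Δ₄` at first coordinate `x ∈ (0,1)` is `S3 x`. [folklore] -/
theorem slice_simplex4 {x : ℝ} (hx : x ∈ Ioo (0 : ℝ) 1) :
    {t : Fin 3 → ℝ | Matrix.vecCons x t ∈ openOrderedSimplex 4} = S3 x := by
  ext t
  exact (cons_mem_simplexLT (w := 3) (x := 1) (t₀ := x) (t := t)).trans (and_iff_right hx)

/-- `ω_{0001}(x, t) = (1/x) · ω_{001}(t)`. [folklore] -/
theorem integrand_m4_cons (x : ℝ) (t : Fin 3 → ℝ) :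
    m4.integrand (Matrix.vecCons x t) = 1 / x * W3 [false, false, true] t := by
  show (∏ i : Fin 4, mzvForm ([false, false, false, true].getD i false) (Matrix.vecCons x t i)) = _
  simp only [W3, Fin.prod_univ_four, Fin.prod_univ_three]
  simp [mzvForm]
  ring

/-- `ω_{0101}(x, t) = (1/x) · ω_{101}(t)`. [folklore] -/
theorem integrand_m22_cons (x : ℝ) (t : Fin 3 → ℝ) :
    m22.integrand (Matrix.vecCons x t) = 1 / x * W3 [true, false, true] t := by
  show (∏ i : Fin 4, mzvForm ([false, true, false, true].getD i false) (Matrix.vecCons x t i)) = _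
  simp only [W3, Fin.prod_univ_four, Fin.prod_univ_three]
  simp [mzvForm]
  ring

/-- **Marginal of `Δ₄`**: `sliceValue [Δ₄] x = Li₃(x)/x` on `(0,1)`. -/
theorem sliceValue_m4 {x : ℝ} (hx : x ∈ Ioo (0 : ℝ) 1) :
    sliceValue m4 x = 1 / x * (li3E x).toReal := by
  rw [sliceValue_def]
  show ∫ t in {t : Fin 3 → ℝ | Matrix.vecCons x t ∈ openOrderedSimplex 4},
    m4.integrand (Matrix.vecCons x t) = _
  rw [slice_simplex4 hx]
  simp_rw [integrand_m4_cons]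
  rw [integral_const_mul, setIntegral_W3 _ hx.2.le, wordLI_false_false_true hx.1.le hx.2.le]

/-- **Marginal of `Δ_{2,2}`**: `sliceValue [Δ_{2,2}] x = Li_{1,2}(x)/x` on `(0,1)`. -/
theorem sliceValue_m22 {x : ℝ} (hx : x ∈ Ioo (0 : ℝ) 1) :
    sliceValue m22 x = 1 / x * (li12E x).toReal := by
  rw [sliceValue_def]
  show ∫ t in {t : Fin 3 → ℝ | Matrix.vecCons x t ∈ openOrderedSimplex 4},
    m22.integrand (Matrix.vecCons x t) = _
  rw [slice_simplex4 hx]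
  simp_rw [integrand_m22_cons]
  rw [integral_const_mul, setIntegral_W3 _ hx.2.le, wordLI_true_false_true hx.1.le hx.2.le]

/-! ### The value `ζ₂` and the slice of the product -/

/-- Membership of a pair in `Δ₂`. [folklore] -/
theorem vec2_mem_openOrderedSimplex {a b : ℝ} :
    (![a, b] : Fin 2 → ℝ) ∈ openOrderedSimplex 2 ↔ 0 < b ∧ b < a ∧ a < 1 := by
  simp only [openOrderedSimplex, mem_setOf_eq]
  constructor
  · rintro ⟨hpos, hlt, hanti⟩
    refine ⟨by simpa using hpos 1, ?_, by simpa using hlt 0⟩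
    simpa using hanti (show (0 : Fin 2) < 1 by decide)
  · rintro ⟨hb, hba, ha⟩
    refine ⟨fun i => ?_, fun i => ?_, fun i j hij => ?_⟩
    · fin_cases i <;> simp <;> linarith
    · fin_cases i <;> simp <;> linarith
    · fin_cases i <;> fin_cases j <;> simp at hij ⊢
      exact hba

/-- `ζ₂ = Li₂(1)` (real value of the `ℝ≥0∞` series). [folklore] -/
theorem ζ₂_eq : ζ₂ = (li2E 1).toReal := by
  have hv : m2.value = ∫ t in openOrderedSimplex 2, mzvIntegrand [2] t := mzvRep_value_eq [2] _ _ _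
  rw [ζ₂, hv]
  have hS : MeasurableSet (openOrderedSimplex 2) := measurableSet_simplexLT 2 1
  have hnn : ∀ t ∈ openOrderedSimplex 2, ∀ (i : Fin 2) b, 0 ≤ mzvForm b (t i) :=
    fun t ht i b => mzvForm_nonneg b (ht.1 i) (ht.2.1 i)
  have hae : 0 ≤ᵐ[volume.restrict (openOrderedSimplex 2)] mzvIntegrand [2] :=
    (ae_restrict_iff' hS).2 (ae_of_all _ fun t ht => Finset.prod_nonneg fun i _ => hnn t ht i _)
  rw [integral_eq_lintegral_of_nonneg_ae hae
    (mzvIntegrand_integrableOn_holds [2] (by decide)).aestronglyMeasurable]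
  congr 1
  rw [← wordLI_false_true zero_le_one le_rfl]
  exact setLIntegral_congr_fun hS fun t ht => ENNReal.ofReal_prod_of_nonneg fun i _ => hnn t ht i _

/-- `ζ₂ > 0`. [folklore] -/
theorem ζ₂_pos : 0 < ζ₂ := by
  have hv : m2.value = multipleZeta [2] := mzvRep_value_holds [2] _ _ _
  rw [ζ₂, hv]
  exact multipleZeta_pos_of_isAdmissible_holds (by decide)

/-- `Li₂(1) < ∞`. [folklore] -/
theorem li2E_one_ne_top : li2E 1 ≠ ∞ := by
  rw [li2E_one]
  exact tsum_inv_sq_ne_top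

/-- First block of `cons x (cons a y)`. [folklore] -/
theorem castAdd_block (z : Fin 4 → ℝ) : (fun i : Fin 2 => z (Fin.castAdd 2 i)) = ![z 0, z 1] := by
  funext i; fin_cases i <;> rfl

/-- Second block. [folklore] -/
theorem natAdd_block (z : Fin 4 → ℝ) : (fun j : Fin 2 => z (Fin.natAdd 2 j)) = ![z 2, z 3] := by
  funext j; fin_cases j <;> rfl

/-- `ω₀ω₁` on a pair. [folklore] -/
theorem integrand_m2_vec (a b : ℝ) : m2.integrand ![a, b] = 1 / a * (1 / (1 - b)) := by
  show (∏ i : Fin 2, mzvForm ([false, true].getD i false) ((![a, b] : Fin 2 → ℝ) i)) = _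
  simp [Fin.prod_univ_two, mzvForm]

/-- The integrand of `Δ₂ × Δ₂` at `cons x t`: `ω(x, t₀) · ω(t₁, t₂)`. [folklore] -/
theorem integrand_p22_cons (x : ℝ) (t : Fin 3 → ℝ) :
    p22.integrand (Matrix.vecCons x t) =
      (1 / x * (1 / (1 - t 0))) * (1 / t 1 * (1 / (1 - t 2))) := by
  have h := IntegralRep.prod_integrand_eq m2 m2
  have h' : p22.integrand = IntegralRep.prodFun m2 m2 := h
  rw [h', IntegralRep.prodFun_apply]
  have e1 : (fun i : Fin 2 => Matrix.vecCons x t (Fin.castAdd 2 i)) = ![x, t 0] := by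
    funext i; fin_cases i <;> rfl
  have e2 : (fun j : Fin 2 => Matrix.vecCons x t (Fin.natAdd 2 j)) = ![t 1, t 2] := by
    funext j; fin_cases j <;> rfl
  rw [e1, e2, integrand_m2_vec, integrand_m2_vec]

/-- The slice of `Δ₂ × Δ₂` at `x ∈ (0,1)`: `{t | t₀ ∈ (0,x), (t₁,t₂) ∈ Δ₂}`. [folklore] -/
theorem slice_p22 {x : ℝ} (hx : x ∈ Ioo (0 : ℝ) 1) (t : Fin 3 → ℝ) :
    Matrix.vecCons x t ∈ p22.domain ↔ t 0 ∈ Ioo 0 x ∧ (![t 1, t 2] : Fin 2 → ℝ) ∈ openOrderedSimplex 2 := by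
  have hd : p22.domain = IntegralRep.prodDomain m2 m2 := rfl
  rw [hd, IntegralRep.mem_prodDomain]
  have e1 : (fun i : Fin 2 => Matrix.vecCons x t (Fin.castAdd 2 i)) = ![x, t 0] := by
    funext i; fin_cases i <;> rfl
  have e2 : (fun j : Fin 2 => Matrix.vecCons x t (Fin.natAdd 2 j)) = ![t 1, t 2] := by
    funext j; fin_cases j <;> rfl
  have hdom : m2.domain = openOrderedSimplex 2 := rfl
  rw [e1, e2, hdom, vec2_mem_openOrderedSimplex]
  constructor
  · rintro ⟨⟨h0, hx0, -⟩, h2⟩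
    exact ⟨⟨h0, hx0⟩, h2⟩
  · rintro ⟨⟨h0, hx0⟩, h2⟩
    exact ⟨⟨h0, hx0, hx.2⟩, h2⟩

/-- `∫_{(0,x)} da/(1−a) = −log(1−x)` for `0 ≤ x < 1`. [folklore] -/
theorem integral_inv_one_sub {x : ℝ} (hx0 : 0 ≤ x) (hx1 : x < 1) :
    ∫ a in Ioo 0 x, 1 / (1 - a) = -Real.log (1 - x) := by
  rw [← integral_Ioc_eq_integral_Ioo, ← intervalIntegral.integral_of_le hx0,
    intervalIntegral.integral_comp_sub_left (fun u => 1 / u) 1]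
  simp only [sub_zero, one_div]
  rw [integral_inv_of_pos (by linarith) one_pos, Real.log_div one_ne_zero (by linarith),
    Real.log_one, zero_sub]

/-- **Marginal of `Δ₂ × Δ₂`**: `sliceValue [Δ₂ × Δ₂] x = ζ₂ · ℓ(x)/x` on `(0,1)`. -/
theorem sliceValue_p22 {x : ℝ} (hx : x ∈ Ioo (0 : ℝ) 1) :
    sliceValue p22 x = 1 / x * (-Real.log (1 - x)) * ζ₂ := by
  rw [sliceValue_def]
  -- pass to an integral over ℝ³ of the indicator, then to ℝ × ℝ²
  set S := {t : Fin 3 → ℝ | Matrix.vecCons x t ∈ p22.domain} with hS_def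
  have hS : MeasurableSet S := measurableSet_slice p22 x
  set f : ℝ → ℝ := (Ioo 0 x).indicator fun a => 1 / x * (1 / (1 - a)) with hf
  set g : (Fin 2 → ℝ) → ℝ := (openOrderedSimplex 2).indicator (fun y => 1 / y 0 * (1 / (1 - y 1)))
    with hg
  have hval : ζ₂ = ∫ y in openOrderedSimplex 2, 1 / y 0 * (1 / (1 - y 1)) := by
    have hv : m2.value = ∫ y in openOrderedSimplex 2, mzvIntegrand [2] y := mzvRep_value_eq [2] _ _ _
    rw [ζ₂, hv]
    congr 1
    funext y
    have hy : (![y 0, y 1] : Fin 2 → ℝ) = y := by funext i; fin_cases i <;> rfl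
    have := integrand_m2_vec (y 0) (y 1)
    rw [hy] at this
    exact this
  have hpt : ∀ t : Fin 3 → ℝ, S.indicator (fun t => p22.integrand (Matrix.vecCons x t)) t =
      f (t 0) * g ![t 1, t 2] := by
    intro t
    by_cases ht : t ∈ S
    · have ht' := (slice_p22 hx t).1 ht
      rw [indicator_of_mem ht, integrand_p22_cons, hf, hg, indicator_of_mem ht'.1,
        indicator_of_mem ht'.2]
      simp
    · rw [indicator_of_notMem ht]
      have ht' : ¬ (t 0 ∈ Ioo 0 x ∧ (![t 1, t 2] : Fin 2 → ℝ) ∈ openOrderedSimplex 2) :=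
        fun h => ht ((slice_p22 hx t).2 h)
      rcases not_and_or.mp ht' with h | h
      · rw [hf, indicator_of_notMem h, zero_mul]
      · rw [hg, indicator_of_notMem h, mul_zero]
  calc ∫ t in S, p22.integrand (Matrix.vecCons x t)
      = ∫ t, S.indicator (fun t => p22.integrand (Matrix.vecCons x t)) t :=
        (integral_indicator hS).symm
    _ = ∫ t : Fin (2 + 1) → ℝ, f (t 0) * g ![t 1, t 2] := integral_congr_ae (ae_of_all _ hpt)
    _ = ∫ p : ℝ × (Fin 2 → ℝ), f p.1 * g p.2 ∂((volume : Measure ℝ).prod volume) := by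
        rw [← integral_comp_vecCons (n := 2) (fun t : Fin (2 + 1) → ℝ => f (t 0) * g ![t 1, t 2])]
        refine integral_congr_ae (ae_of_all _ fun p => ?_)
        simp only [Matrix.cons_val_zero]
        congr 1
        congr 1
        funext i; fin_cases i <;> rfl
    _ = (∫ a, f a) * ∫ y, g y := integral_prod_mul f g
    _ = 1 / x * (-Real.log (1 - x)) * ζ₂ := by
        rw [hf, integral_indicator measurableSet_Ioo, integral_const_mul,
          integral_inv_one_sub hx.1.le hx.2, hg,
          integral_indicator (measurableSet_openOrderedSimplex 2), hval]

/-! ### The marginal of the first genuine stuffle defect -/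

/-- `Zcan [2] · Zcan [2] = [p22]`. [folklore] -/
theorem Zcan_two_mul : Zcan [2] * Zcan [2] = of p22 := by
  rw [Zcan_of_isAdmissible [2] (by decide), simplexOf_mul_simplexOf]
  rfl

/-- The defect at `s = t = [2]`, as a combination of the four representations. [folklore] -/
theorem defect_two_two_eq : defect Zcan [2] [2] = of p22 - (of m22 + of m22 + of m4) := by
  have h22 : IsAdmissible [2, 2] := by decide
  have h4 : IsAdmissible [4] := by decide
  rw [defect, Zcan_two_mul]
  simp only [MZV.stuffle_cons_cons, MZV.stuffle_nil_left, MZV.stuffle_nil_right, List.map_cons,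
    List.map_nil, List.sum_cons, List.sum_nil, List.nil_append, List.cons_append, add_zero]
  rw [Zcan_of_isAdmissible _ h22, Zcan_of_isAdmissible _ h4]
  simp only [simplexOf]
  abel_nf
  rfl

/-- **The marginal of the (2,2) defect** on `(0,1)`:
`sliceEval D x = (ζ₂ ℓ(x) − 2 Li_{1,2}(x) − Li₃(x)) / x`. -/
theorem sliceEval_defect_two_two {x : ℝ} (hx : x ∈ Ioo (0 : ℝ) 1) :
    sliceEval (defect Zcan [2] [2]) x =
      1 / x * (ζ₂ * (-Real.log (1 - x)) - 2 * (li12E x).toReal - (li3E x).toReal) := by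
  rw [defect_two_two_eq, map_sub, map_add, map_add]
  rw [show sliceEval (of p22) = sliceValue p22 from sliceEval_of p22,
    show sliceEval (of m22) = sliceValue m22 from sliceEval_of m22,
    show sliceEval (of m4) = sliceValue m4 from sliceEval_of m4]
  simp only [Pi.sub_apply, Pi.add_apply]
  rw [sliceValue_p22 hx, sliceValue_m22 hx, sliceValue_m4 hx]
  ring

end Slices

end Summit.KontsevichZagierPeriods.Theorems.StuffleInKZ.Negative
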